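import Literature.Geometry.Lorentzian.CoordCurvatureNormSq
import Mathlib.Analysis.Matrix.Spectrum
import HarnessLib

/-!
# Orthonormal eigenframes of a symmetric form relative to positive definite metric components

Simultaneous diagonalisation, in the coordinate language of `CoordCurvature.lean`: for metric
components `G` symmetric and positive definite at `x` and a symmetric bilinear form `β` there is a
`G_x`-orthonormal basis `e` of the model space consisting of `β`-eigenvectors,
`β(eᵢ, ·) = μᵢ G_x(eᵢ, ·)` (`exists_orthonormal_eigenframe`). Proof: a `G_x`-orthonormal basis
`e⁰` (`exists_orthonormal_basis`) identifies `(E, G_x)` with Euclidean space; the real symmetric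
matrix `β(e⁰ᵢ, e⁰ⱼ)` has an orthonormal basis of eigenvectors (Mathlib's spectral theorem
`Matrix.IsHermitian.eigenvectorBasis`), whose images `eᵢ = Σ_k vᵢₖ e⁰_k` form the frame. This is
the frame in which Eminenti–La Nave–Mantegazza evaluate `Δ(R_{ij}/R)` at the minimum point of
`λ_min(Ric)/R` (§3, p. 7: "`λ_min` … the minimal eigenvalue of the Ricci tensor … with eigenvector
`v_p`"), cf. `CoordRicciEigenframe.lean`.

Everything is proved; no definitions are introduced.

## References

* B. O'Neill, *Semi-Riemannian geometry*, 1983, Ch. 2, Lemma 2.24 ff.; Ch. 9, Lemma 9.13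
  (self-adjoint operators relative to a positive definite scalar product are diagonalisable). [ONeill1983]
* M. Eminenti, G. La Nave, C. Mantegazza, manuscripta math. 127 (2008), §3 (p. 7). [EminentiLanaveMantegazza2008]
-/

noncomputable section

open Module Matrix

namespace Literature.Geometry.Lorentzian

namespace MetricCoord

variable {E : Type*} [NormedAddCommGroup E] [NormedSpace ℝ E] [FiniteDimensional ℝ E]
  {G : E → E →L[ℝ] E →L[ℝ] ℝ} {x : E}

omit [FiniteDimensional ℝ E] in
/-- `G`-orthonormal vectors are linearly independent (a local copy of
`MetricCoord.linearIndependent_of_orthonormal` of `ConformalIsotropicCurvature.lean`, kept private to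
avoid that file's imports). [cite: ONeill1983, Ch. 2, Lemma 2.25] -/
private theorem linearIndependent_of_orthonormal_aux {ι : Type*} [Fintype ι] [DecidableEq ι] {e : ι → E}
    (he : ∀ i j, G x (e i) (e j) = if i = j then 1 else 0) : LinearIndependent ℝ e := by
  rw [Fintype.linearIndependent_iff]
  intro c hc i
  have h := congrArg (fun v ↦ G x v (e i)) hc
  simp only [map_sum, map_smul, FunLike.coe_sum, Finset.sum_apply,
    FunLike.coe_smul, Pi.smul_apply, smul_eq_mul, he, mul_ite, mul_one, mul_zero,
    Finset.sum_ite_eq', Finset.mem_univ, if_true, map_zero, _root_.zero_apply] at h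
  exact h

/-- **Orthonormal eigenframes** (simultaneous diagonalisation): for `G_x` symmetric positive
definite and `β` symmetric there are a `G_x`-orthonormal basis `e` and reals `μᵢ` with
`β(eᵢ, w) = μᵢ G_x(eᵢ, w)` for all `w`. [cite: ONeill1983, Ch. 9, Lemma 9.13]
[cite: EminentiLanaveMantegazza2008, §3 (p. 7)] -/
theorem exists_orthonormal_eigenframe (hs : ∀ v w, G x v w = G x w v)
    (hpos : ∀ v, v ≠ 0 → 0 < G x v v) (β : E →L[ℝ] E →L[ℝ] ℝ) (hβ : ∀ v w, β v w = β w v) :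
    ∃ (e : Basis (Fin (finrank ℝ E)) ℝ E) (μ : Fin (finrank ℝ E) → ℝ),
      (∀ i j, G x (e i) (e j) = if i = j then 1 else 0) ∧
        ∀ i w, β (e i) w = μ i * G x (e i) w := by
  classical
  obtain ⟨e₀, he₀⟩ := exists_orthonormal_basis hs hpos
  -- the symmetric matrix of `β` in the frame `e₀` and its eigenvectors
  set A : Matrix (Fin (finrank ℝ E)) (Fin (finrank ℝ E)) ℝ :=
    Matrix.of fun i j ↦ β (e₀ i) (e₀ j) with hAdef
  have hA : A.IsHermitian := by
    refine Matrix.IsHermitian.ext fun i j ↦ ?_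
    simp only [hAdef, Matrix.of_apply, star_trivial, hβ]
  set v := hA.eigenvectorBasis with hv
  set μ := hA.eigenvalues with hμ
  -- the frame `eᵢ = Σ_k vᵢₖ e₀ₖ`
  set f : Fin (finrank ℝ E) → E := fun i ↦ ∑ k, (v i) k • e₀ k with hf
  have hGf : ∀ i w, G x (f i) w = ∑ k, (v i) k * G x (e₀ k) w := fun i w ↦ by
    simp only [hf, map_sum, map_smul, FunLike.coe_sum, Finset.sum_apply,
      FunLike.coe_smul, Pi.smul_apply, smul_eq_mul]
  have hβf : ∀ i w, β (f i) w = ∑ k, (v i) k * β (e₀ k) w := fun i w ↦ by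
    simp only [hf, map_sum, map_smul, FunLike.coe_sum, Finset.sum_apply,
      FunLike.coe_smul, Pi.smul_apply, smul_eq_mul]
  -- `G(fᵢ, e₀ₗ) = vᵢₗ`
  have hGf0 : ∀ i l, G x (f i) (e₀ l) = (v i) l := fun i l ↦ by
    rw [hGf]
    simp only [he₀, mul_ite, mul_one, mul_zero, Finset.sum_ite_eq', Finset.mem_univ, if_true]
  -- orthonormality: `G(fᵢ, fⱼ) = ⟪vᵢ, vⱼ⟫ = δᵢⱼ`
  have horth : ∀ i j, G x (f i) (f j) = if i = j then 1 else 0 := by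
    intro i j
    have h1 : G x (f i) (f j) = ∑ k, (v i) k * (v j) k := by
      rw [hs, hGf]
      refine Finset.sum_congr rfl fun k _ ↦ ?_
      rw [hs, hGf0]
      ring
    have h2 : (inner ℝ (v i) (v j) : ℝ) = ∑ k, (v i) k * (v j) k := by
      rw [PiLp.inner_apply]
      refine Finset.sum_congr rfl fun k _ ↦ ?_
      simp [mul_comm]
    rw [h1, ← h2]
    exact orthonormal_iff_ite.mp v.orthonormal i j
  -- eigen-property on the frame `e₀`, then everywhere by linearity
  have heig0 : ∀ i l, β (f i) (e₀ l) = μ i * G x (f i) (e₀ l) := by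
    intro i l
    have hmv := congrFun (hA.mulVec_eigenvectorBasis i) l
    simp only [Matrix.mulVec, dotProduct, Pi.smul_apply, smul_eq_mul] at hmv
    rw [hβf, hGf0]
    calc ∑ k, (v i) k * β (e₀ k) (e₀ l) = ∑ k, A l k * (v i) k := by
          refine Finset.sum_congr rfl fun k _ ↦ ?_
          rw [hAdef, Matrix.of_apply, hβ]
          ring
      _ = μ i * (v i) l := hmv
  have heig : ∀ i w, β (f i) w = μ i * G x (f i) w := by
    intro i w
    conv_lhs => rw [← sum_apply_smul_of_orthonormal e₀ he₀ w]
    conv_rhs => rw [← sum_apply_smul_of_orthonormal e₀ he₀ w]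
    simp only [map_sum, map_smul, smul_eq_mul, heig0, Finset.mul_sum]
    refine Finset.sum_congr rfl fun l _ ↦ ?_
    ring
  -- `f` is a basis
  have hli : LinearIndependent ℝ f := linearIndependent_of_orthonormal_aux horth
  have hcard : Fintype.card (Fin (finrank ℝ E)) = finrank ℝ E := by rw [Fintype.card_fin]
  have hspan : ⊤ ≤ Submodule.span ℝ (Set.range f) := (hli.span_eq_top_of_card_eq_finrank' hcard).ge
  refine ⟨Basis.mk hli hspan, μ, fun i j ↦ ?_, fun i w ↦ ?_⟩
  · rw [Basis.coe_mk]; exact horth i j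
  · rw [Basis.coe_mk]; exact heig i w

end MetricCoord

end Literature.Geometry.Lorentzian

end
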